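import Literature.MathematicalPhysics.QuantumLattice.GrassmannLaplacianTreeExpansion
import Literature.MathematicalPhysics.QuantumLattice.GrassmannLaplacianPairWick
import Literature.MathematicalPhysics.QuantumLattice.GrassmannKernelsGenProd
import Literature.MathematicalPhysics.QuantumLattice.GrassmannParity
import Literature.Probability.LatticeModels.CumulantExponentialClosedForm
import HarnessLib

/-!
# Collapsing replicas: `ψ_{(a,X)} ↦ ψ_X` intertwines the Gaussian convolutions

Topic `Literature/MathematicalPhysics/QuantumLattice`.  The truncated expectations `𝓔ᵀ_C(V; n)` of
`n` copies of ONE even element `V` (Benfatto–Giuliani–Mastropietro 2006, (2.13)–(2.14); Mastropietro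
2008, (2.34)–(2.36)) are obtained from the cluster-labelled truncated expectations of this library
(`ursellOf (convMoment C' M) univ`, `GrassmannLaplacianTreeExpansion.lean`) by **replicas**: the copies
live on `Γ' = Fin n × Γ` with the replica-blind covariance `C'((a,X),(b,Y)) = C(X,Y)` (`C.submatrix snd
snd`), and the algebra homomorphism `collapse snd : ψ_{(a,X)} ↦ ψ_X` maps everything back.  More
generally, for any `φ : Γ' → Γ`:

* `collapseLM φ`, `collapse φ = ⋀(collapseLM φ)`, `collapse_gen` (`ψ_Y ↦ ψ_{φ Y}`), `collapse_genProd`;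
* `grassmannDeriv_collapse` — **`∂_X ∘ collapse = collapse ∘ Σ_{φ Y = X} ∂_Y`**;
  `grassmannLaplacian_collapse` — `Δ_C ∘ collapse = collapse ∘ Δ_{C ∘ (φ × φ)}`; `collapse_exp_apply`,
  **`gaussConv_collapse`** — `e^{Δ_C} ∘ collapse = collapse ∘ e^{Δ_{C∘(φ×φ)}}`;
* `collapseEven` (the restriction to the even parts, a homomorphism of commutative rings),
  `collapseEven_evenGaussConv`, `collapseEven_convMoment`, **`collapseEven_ursellOf_convMoment`** (naturality
  of the Ursell function) and **`collapseEven_ursellOf_convMoment_eq_cumulantOf`**: if all the `M_a`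
  collapse to the same `X`, the collapsed truncated expectation is the cumulant
  `cumulantOf (k ↦ e^{Δ_C}(X^k)) n = 𝓔ᵀ_C(X; n)`, whose exponential generating function is
  `log Σ_k e^{Δ_C}(X^k) t^k/k!` (`egf_evenGaussConv_pow_eq_exp_subst`);
* replica data for `φ = snd`: `replicaKer` (a kernel placed in copy `a`), its support, its anchored sums
  (`sum_filter_norm_replicaKer_le`), `collapse_sum_replicaKer_smul_genProd`; the charged/Gram and row-sum
  data of `C.submatrix snd snd` (`contr_submatrix`, `sum_norm_typeRestrict_submatrix_le`,
  `sum_norm_typeRestrict_submatrix_le'`).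

Everything is proved; no named fact.

## Sources

G. Benfatto, A. Giuliani, V. Mastropietro, Ann. Henri Poincaré 7 (2006) 809–898, (2.13)–(2.14), (2.66)
(`BenfattoGiulianiMastropietro2006`); V. Mastropietro, *Non-Perturbative Renormalization* (2008), §2.3
(2.34)–(2.36) (`Mastropietro2008`).
-/

noncomputable section

namespace Literature.MathematicalPhysics.QuantumLattice

open GrassmannAlgebra Finset Literature.Probability.LatticeModels

/-! ### The collapse homomorphism -/

section Collapse

variable (R : Type*) [CommRing R] {Γ Γ' : Type*} [Fintype Γ'] [DecidableEq Γ] (φ : Γ' → Γ)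

/-- The push-forward of coefficient vectors along `φ`: `(collapseLM φ v)(X) = Σ_{φ Y = X} v(Y)`. [folklore] -/
def collapseLM : (Γ' → R) →ₗ[R] (Γ → R) where
  toFun v X := ∑ Y ∈ univ.filter (fun Y => φ Y = X), v Y
  map_add' v w := by
    funext X
    simp [sum_add_distrib]
  map_smul' r v := by
    funext X
    simp [mul_sum]

/-- Unfolding `collapseLM`. [folklore] -/
theorem collapseLM_apply (v : Γ' → R) (X : Γ) : collapseLM R φ v X = ∑ Y ∈ univ.filter (fun Y => φ Y = X), v Y := rfl

/-- `collapseLM` on a basis vector. [folklore] -/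
theorem collapseLM_single [DecidableEq Γ'] (Y : Γ') (r : R) : collapseLM R φ (Pi.single Y r) = Pi.single (φ Y) r := by
  funext X
  rw [collapseLM_apply]
  by_cases h : φ Y = X
  · rw [sum_eq_single_of_mem Y (mem_filter.2 ⟨mem_univ _, h⟩) fun Z _ hZ => Pi.single_eq_of_ne hZ _, Pi.single_eq_same, ← h,
      Pi.single_eq_same]
  · rw [Pi.single_eq_of_ne (Ne.symm h), sum_eq_zero]
    intro Z hZ
    exact Pi.single_eq_of_ne (fun hZY => h (by rw [← hZY]; exact (mem_filter.1 hZ).2)) _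

/-- **The collapse homomorphism** `ψ_Y ↦ ψ_{φ Y}` (for `φ = snd : Fin n × Γ → Γ`: forgetting the replica
index). [folklore] -/
def collapse : GrassmannAlgebra R Γ' →ₐ[R] GrassmannAlgebra R Γ :=
  ExteriorAlgebra.map (collapseLM R φ)

/-- `collapse` on degree one. [folklore] -/
theorem collapse_ι (v : Γ' → R) : collapse R φ (ExteriorAlgebra.ι R v) = ExteriorAlgebra.ι R (collapseLM R φ v) :=
  ExteriorAlgebra.map_apply_ι _ _

/-- **`collapse (ψ_Y) = ψ_{φ Y}`.** [folklore] -/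
@[simp] theorem collapse_gen [DecidableEq Γ'] (Y : Γ') : collapse R φ (gen R Y) = gen R (φ Y) := by
  rw [gen, collapse_ι, collapseLM_single]
  rfl

/-- `collapse` on a monomial. [folklore] -/
theorem collapse_genProd [DecidableEq Γ'] : ∀ {m : ℕ} (Y : Fin m → Γ'), collapse R φ (genProd R Y) = genProd R (φ ∘ Y)
  | 0, Y => by rw [genProd_zero, genProd_zero, map_one]
  | m + 1, Y => by
    rw [genProd_succ, genProd_succ, map_mul, collapse_gen, collapse_genProd (Fin.tail Y)]
    rfl

/-- **The derivative of a collapsed element**: `∂_X (collapse a) = collapse (Σ_{φ Y = X} ∂_Y a)`. [folklore] -/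
theorem grassmannDeriv_collapse (X : Γ) (a : GrassmannAlgebra R Γ') :
    grassmannDeriv R X (collapse R φ a) = collapse R φ (∑ Y ∈ univ.filter (fun Y => φ Y = X), grassmannDeriv R Y a) := by
  induction a using CliffordAlgebra.left_induction with
  | algebraMap r => simp
  | add x y hx hy => simp only [map_add, hx, hy, sum_add_distrib]
  | ι_mul x v hx =>
    rw [map_mul, show CliffordAlgebra.ι (0 : QuadraticForm R (Γ' → R)) v = ExteriorAlgebra.ι R v from rfl, collapse_ι,
      grassmannDeriv_ι_mul, hx, collapseLM_apply]
    simp only [grassmannDeriv_ι_mul, sum_sub_distrib, map_sub, map_sum, map_smul, map_mul, collapse_ι, ← sum_smul, mul_sum]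

variable [Fintype Γ] [Algebra ℚ R]

/-- **The Laplacian of a collapsed element**: `Δ_C (collapse a) = collapse (Δ_{C ∘ (φ × φ)} a)`. [folklore] -/
theorem grassmannLaplacian_collapse (C : Matrix Γ Γ R) (a : GrassmannAlgebra R Γ') :
    grassmannLaplacian R C (collapse R φ a) = collapse R φ (grassmannLaplacian R (C.submatrix φ φ) a) := by
  rw [grassmannLaplacian_apply, grassmannLaplacian_apply, map_smul, map_sum]
  congr 1
  simp only [map_sum, map_smul, grassmannDeriv_collapse, Matrix.submatrix_apply]
  symm
  rw [← sum_fiberwise univ φ]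
  refine sum_congr rfl fun X _ => ?_
  -- inner: both sides as double fibre sums
  symm
  calc ∑ Y, C X Y • ∑ Y' ∈ univ.filter (fun Y' => φ Y' = Y), ∑ X' ∈ univ.filter (fun X' => φ X' = X),
          collapse R φ (grassmannDeriv R X' (grassmannDeriv R Y' a))
      = ∑ Y, ∑ Y' ∈ univ.filter (fun Y' => φ Y' = Y), ∑ X' ∈ univ.filter (fun X' => φ X' = X),
          C (φ X') (φ Y') • collapse R φ (grassmannDeriv R X' (grassmannDeriv R Y' a)) := by
        refine sum_congr rfl fun Y _ => ?_
        rw [smul_sum]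
        refine sum_congr rfl fun Y' hY' => ?_
        rw [smul_sum]
        refine sum_congr rfl fun X' hX' => ?_
        rw [(mem_filter.1 hX').2, (mem_filter.1 hY').2]
    _ = ∑ Y', ∑ X' ∈ univ.filter (fun X' => φ X' = X), C (φ X') (φ Y') • collapse R φ (grassmannDeriv R X' (grassmannDeriv R Y' a)) :=
        sum_fiberwise univ φ _
    _ = ∑ X' ∈ univ.filter (fun X' => φ X' = X), ∑ Y', C (φ X') (φ Y') • collapse R φ (grassmannDeriv R X' (grassmannDeriv R Y' a)) :=
        sum_comm

omit [Fintype Γ] in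
/-- Collapsing intertwines nilpotent exponentials of intertwined operators. [folklore] -/
theorem collapse_exp_apply {T' : Module.End R (GrassmannAlgebra R Γ')} {T : Module.End R (GrassmannAlgebra R Γ)}
    (hT' : IsNilpotent T') (hT : IsNilpotent T) (h : ∀ a, collapse R φ (T' a) = T (collapse R φ a)) (a : GrassmannAlgebra R Γ') :
    collapse R φ (IsNilpotent.exp T' a) = IsNilpotent.exp T (collapse R φ a) := by
  obtain ⟨k', hk'⟩ := hT'
  obtain ⟨k, hk⟩ := hT
  have h1 : T' ^ (k + k') = 0 := by rw [pow_add, hk', mul_zero]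
  have h2 : T ^ (k + k') = 0 := by rw [pow_add, hk, zero_mul]
  have hpow : ∀ (i : ℕ) (b : GrassmannAlgebra R Γ'), collapse R φ ((T' ^ i) b) = (T ^ i) (collapse R φ b) := by
    intro i
    induction i with
    | zero => intro b; simp
    | succ i ih => intro b; rw [pow_succ', pow_succ', Module.End.mul_apply, Module.End.mul_apply, h, ih]
  rw [IsNilpotent.exp_eq_sum h1, IsNilpotent.exp_eq_sum h2, LinearMap.sum_apply, LinearMap.sum_apply, map_sum]
  refine sum_congr rfl fun i _ => ?_
  rw [LinearMap.smul_apply, LinearMap.smul_apply, map_rat_smul (collapse R φ), hpow]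

/-- **The Gaussian convolution of a collapsed element**: `e^{Δ_C} (collapse a) = collapse (e^{Δ_{C∘(φ×φ)}} a)` —
the replica-blind covariance integrates the copies as one field. [cite: BenfattoGiulianiMastropietro2006, (2.13)-(2.14)] -/
theorem gaussConv_collapse (C : Matrix Γ Γ R) (a : GrassmannAlgebra R Γ') :
    gaussConv R C (collapse R φ a) = collapse R φ (gaussConv R (C.submatrix φ φ) a) := by
  rw [gaussConv_def, gaussConv_def]
  exact (collapse_exp_apply R φ (isNilpotent_grassmannLaplacian R _) (isNilpotent_grassmannLaplacian R C)
    (fun b => (grassmannLaplacian_collapse R φ C b).symm) a).symm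

/-! ### On the even parts -/

/-- `collapse` restricted to the even parts, a homomorphism of commutative rings. [folklore] -/
def collapseEven : evenPart R Γ' →ₐ[R] evenPart R Γ :=
  ((collapse R φ).comp (evenPart R Γ').val).codRestrict (evenPart R Γ) fun x => map_mem_evenOdd_zero R _ x.2

omit [Fintype Γ] [Algebra ℚ R] in
/-- Unfolding `collapseEven`. [folklore] -/
@[simp] theorem coe_collapseEven (x : evenPart R Γ') : (collapseEven R φ x : GrassmannAlgebra R Γ) = collapse R φ x := rfl

/-- `collapseEven` intertwines the Gaussian convolutions. [folklore] -/
theorem collapseEven_evenGaussConv (C : Matrix Γ Γ R) (x : evenPart R Γ') :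
    collapseEven R φ (evenGaussConv R (C.submatrix φ φ) x) = evenGaussConv R C (collapseEven R φ x) :=
  Subtype.ext (by rw [coe_collapseEven, coe_evenGaussConv, coe_evenGaussConv, coe_collapseEven, gaussConv_collapse])

/-- `collapseEven` on the moments of a family. [folklore] -/
theorem collapseEven_convMoment {ι : Type*} (C : Matrix Γ Γ R) (M : ι → evenPart R Γ') (Q : Finset ι) :
    collapseEven R φ (convMoment R (C.submatrix φ φ) M Q) = evenGaussConv R C (∏ a ∈ Q, collapseEven R φ (M a)) := by
  rw [convMoment, collapseEven_evenGaussConv, map_prod]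

/-- **Naturality of the truncated expectations under collapse.** [folklore] -/
theorem collapseEven_ursellOf_convMoment {ι : Type*} [DecidableEq ι] (C : Matrix Γ Γ R) (M : ι → evenPart R Γ') {Q : Finset ι}
    (hQ : Q.Nonempty) :
    collapseEven R φ (ursellOf (convMoment R (C.submatrix φ φ) M) Q) =
      ursellOf (fun P => evenGaussConv R C (∏ a ∈ P, collapseEven R φ (M a))) Q := by
  rw [show (collapseEven R φ (ursellOf (convMoment R (C.submatrix φ φ) M) Q)) =
      (collapseEven R φ).toRingHom (ursellOf (convMoment R (C.submatrix φ φ) M) Q) from rfl,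
    ← ursellOf_ringHom (collapseEven R φ).toRingHom _ hQ]
  congr 1
  funext P
  exact collapseEven_convMoment R φ C M P

/-- **Copies collapsing to one element give its cumulants**: if `collapse (M a) = X` for all `a`, then
`collapse 𝓔ᵀ_{C'}(M_a : a ∈ Q) = cumulantOf (k ↦ e^{Δ_C}(X^k)) |Q| = 𝓔ᵀ_C(X; |Q|)`
(Benfatto–Giuliani–Mastropietro 2006, (2.14); Mastropietro 2008, (2.34)). [cite: Mastropietro2008, §2.3 (2.34)-(2.35)] -/
theorem collapseEven_ursellOf_convMoment_eq_cumulantOf {ι : Type*} [DecidableEq ι] (C : Matrix Γ Γ R) (M : ι → evenPart R Γ')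
    (X : evenPart R Γ) (hM : ∀ a, collapseEven R φ (M a) = X) {Q : Finset ι} (hQ : Q.Nonempty) :
    collapseEven R φ (ursellOf (convMoment R (C.submatrix φ φ) M) Q) = cumulantOf (fun k => evenGaussConv R C (X ^ k)) Q.card := by
  rw [collapseEven_ursellOf_convMoment R φ C M hQ, ← ursellOf_card]
  congr 1
  funext P
  rw [prod_congr rfl fun a _ => hM a, prod_const]

omit [DecidableEq Γ] in
/-- **`Σ_k e^{Δ_C}(X^k) t^k/k! = exp Σ_{k≥1} 𝓔ᵀ_C(X; k) t^k/k!`** in `⋀^{even}⟦t⟧` (the exponential formula,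
`CumulantExponentialClosedForm`). [cite: Mastropietro2008, §2.3 (2.35)-(2.36)] -/
theorem egf_evenGaussConv_pow_eq_exp_subst (C : Matrix Γ Γ R) (X : evenPart R Γ) :
    egf (fun k => evenGaussConv R C (X ^ k)) =
      (PowerSeries.exp (evenPart R Γ)).subst (egfPos (cumulantOf fun k => evenGaussConv R C (X ^ k))) := by
  refine egf_eq_exp_subst_egfPos_cumulantOf _ ?_
  show evenGaussConv R C (X ^ 0) = 1
  rw [pow_zero]
  exact Subtype.ext (by rw [coe_evenGaussConv, OneMemClass.coe_one, gaussConv_one])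

end Collapse

/-! ### Replicas: kernels placed in one copy, and the replica-blind covariance -/

section Replica

variable (R : Type*) [CommRing R] {Γ : Type*} [Fintype Γ] [DecidableEq Γ] {n m : ℕ}

/-- A kernel placed in the copy `a`: `K'_a(Y') = [all Y'_j in copy a] K(snd ∘ Y')`. [folklore] -/
def replicaKer (K : (Fin m → Γ) → R) (a : Fin n) : (Fin m → Fin n × Γ) → R :=
  fun Y' => if ∀ j, (Y' j).1 = a then K (fun j => (Y' j).2) else 0

omit [Fintype Γ] [DecidableEq Γ] in
/-- A replica kernel is supported in its copy. [folklore] -/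
theorem replicaKer_support (K : (Fin m → Γ) → R) (a : Fin n) (Y' : Fin m → Fin n × Γ) (h : replicaKer R K a Y' ≠ 0) :
    ∀ j, (Y' j).1 = a := by
  by_contra hj
  exact h (if_neg hj)

/-- The labels of copy `a`. [folklore] -/
def copyEmb (a : Fin n) : (Fin m → Γ) ↪ (Fin m → Fin n × Γ) :=
  ⟨fun Y j => (a, Y j), fun _ _ h => funext fun j => congrArg Prod.snd (congrFun h j)⟩

omit [Fintype Γ] [DecidableEq Γ] in
/-- The label families of copy `a` are the image of `copyEmb a`. [folklore] -/
theorem filter_forall_fst_eq [Fintype Γ] (a : Fin n) :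
    (univ.filter fun Y' : Fin m → Fin n × Γ => ∀ j, (Y' j).1 = a) = univ.map (copyEmb (m := m) a) := by
  ext Y'
  simp only [mem_filter, mem_univ, true_and, mem_map, copyEmb, Function.Embedding.coeFn_mk]
  constructor
  · intro h
    exact ⟨fun j => (Y' j).2, funext fun j => Prod.ext (h j).symm rfl⟩
  · rintro ⟨Y, rfl⟩ j
    rfl

omit [Fintype Γ] [DecidableEq Γ] in
/-- `replicaKer` on its copy. [folklore] -/
@[simp] theorem replicaKer_copyEmb (K : (Fin m → Γ) → R) (a : Fin n) (Y : Fin m → Γ) : replicaKer R K a (copyEmb a Y) = K Y := by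
  simp [replicaKer, copyEmb]

/-- **Collapsing the vertex of a replica kernel gives back the vertex**:
`collapse (Σ_{Y'} K'_a(Y') ψ(Y')) = Σ_Y K(Y) ψ(Y)`. [folklore] -/
theorem collapse_sum_replicaKer_smul_genProd (K : (Fin m → Γ) → R) (a : Fin n) :
    collapse R (Prod.snd : Fin n × Γ → Γ) (∑ Y' : Fin m → Fin n × Γ, replicaKer R K a Y' • genProd R Y') =
      ∑ Y : Fin m → Γ, K Y • genProd R Y := by
  rw [map_sum]
  have hzero : ∀ Y' : Fin m → Fin n × Γ, Y' ∉ univ.map (copyEmb a) →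
      collapse R (Prod.snd : Fin n × Γ → Γ) (replicaKer R K a Y' • genProd R Y') = 0 := by
    intro Y' hY'
    rw [← filter_forall_fst_eq, mem_filter, not_and] at hY'
    rw [replicaKer, if_neg (hY' (mem_univ _)), zero_smul, map_zero]
  rw [← sum_subset (subset_univ (univ.map (copyEmb a))) fun Y' _ hY' => hzero Y' hY', sum_map]
  refine sum_congr rfl fun Y _ => ?_
  rw [map_smul, replicaKer_copyEmb, collapse_genProd]
  rfl

end Replica

section ReplicaNorms

variable {𝕜 : Type*} [RCLike 𝕜] {Γ : Type*} [Fintype Γ] [DecidableEq Γ] {n m : ℕ}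

/-- **The anchored sums of a replica kernel are those of the kernel** (zero in the other copies). [folklore] -/
theorem sum_filter_norm_replicaKer_le (K : (Fin m → Γ) → 𝕜) (a : Fin n) {N : ℝ}
    (hN : ∀ (j : Fin m) (w : Γ), ∑ Y ∈ univ.filter (fun Y : Fin m → Γ => Y j = w), ‖K Y‖ ≤ N)
    (j : Fin m) (bw : Fin n × Γ) :
    ∑ Y' ∈ univ.filter (fun Y' : Fin m → Fin n × Γ => Y' j = bw), ‖replicaKer 𝕜 K a Y'‖ ≤ N := by
  have hzero : ∀ Y' : Fin m → Fin n × Γ, Y' ∉ univ.map (copyEmb a) → ‖replicaKer 𝕜 K a Y'‖ = 0 := by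
    intro Y' hY'
    rw [← filter_forall_fst_eq, mem_filter, not_and] at hY'
    rw [replicaKer, if_neg (hY' (mem_univ _)), norm_zero]
  calc ∑ Y' ∈ univ.filter (fun Y' : Fin m → Fin n × Γ => Y' j = bw), ‖replicaKer 𝕜 K a Y'‖
      = ∑ Y' ∈ (univ.map (copyEmb (m := m) a)).filter (fun Y' => Y' j = bw), ‖replicaKer 𝕜 K a Y'‖ := by
        symm
        refine sum_subset (filter_subset_filter _ (subset_univ _)) fun Y' hY' hY'2 => hzero Y' fun hmem => ?_
        exact hY'2 (mem_filter.2 ⟨hmem, (mem_filter.1 hY').2⟩)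
    _ = ∑ Y ∈ univ.filter (fun Y : Fin m → Γ => copyEmb (n := n) a Y j = bw), ‖K Y‖ := by
        rw [filter_map, sum_map]
        exact sum_congr rfl fun Y _ => by rw [replicaKer_copyEmb]
    _ ≤ ∑ Y ∈ univ.filter (fun Y : Fin m → Γ => Y j = bw.2), ‖K Y‖ := by
        refine sum_le_sum_of_subset_of_nonneg (fun Y hY => ?_) fun _ _ _ => norm_nonneg _
        rw [mem_filter] at hY ⊢
        exact ⟨mem_univ _, by rw [← hY.2]; rfl⟩
    _ ≤ N := hN j bw.2

omit [Fintype Γ] [DecidableEq Γ] in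
/-- The charged pairing of the replica-blind covariance. [folklore] -/
theorem contr_submatrix {Γ' : Type*} (C : Matrix Γ Γ 𝕜) (φ : Γ' → Γ) (X' Y' : Γ') :
    contr 𝕜 (C.submatrix φ φ) X' Y' = contr 𝕜 C (φ X') (φ Y') := by
  simp [contr_apply]

omit [DecidableEq Γ] in
/-- **The row sums of the type-restricted replica-blind covariance are one-copy row sums.** [folklore] -/
theorem sum_norm_typeRestrict_submatrix_le (C : Matrix Γ Γ 𝕜) {α : ℝ} (hα : 0 ≤ α) (hrow : ∀ X, ∑ Y, ‖C X Y‖ ≤ α)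
    (ℓ : Sym2 (Fin n)) (X' : Fin n × Γ) :
    ∑ Y' : Fin n × Γ, ‖typeRestrict (C.submatrix Prod.snd Prod.snd) Prod.fst ℓ X' Y'‖ ≤ α := by
  rw [Fintype.sum_prod_type]
  simp only [typeRestrict_apply, Matrix.submatrix_apply]
  have hb : ∀ b : Fin n, ∑ Y : Γ, ‖(if s(X'.1, b) = ℓ then C X'.2 Y else 0 : 𝕜)‖ = if s(X'.1, b) = ℓ then ∑ Y, ‖C X'.2 Y‖ else 0 := by
    intro b
    split_ifs <;> simp
  simp only [hb]
  by_cases h : ∃ b, s(X'.1, b) = ℓ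
  · obtain ⟨b₀, hb₀⟩ := h
    rw [Fintype.sum_eq_single b₀ fun b hb' => if_neg fun hb'' => hb' (Sym2.congr_right.1 (hb''.trans hb₀.symm)), if_pos hb₀]
    exact hrow _
  · rw [Fintype.sum_eq_zero _ fun b => if_neg fun hb' => h ⟨b, hb'⟩]
    exact hα

omit [DecidableEq Γ] in
/-- … and the column sums are one-copy column sums. [folklore] -/
theorem sum_norm_typeRestrict_submatrix_le' (C : Matrix Γ Γ 𝕜) {α : ℝ} (hα : 0 ≤ α) (hcol : ∀ Y, ∑ X, ‖C X Y‖ ≤ α)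
    (ℓ : Sym2 (Fin n)) (Y' : Fin n × Γ) :
    ∑ X' : Fin n × Γ, ‖typeRestrict (C.submatrix Prod.snd Prod.snd) Prod.fst ℓ X' Y'‖ ≤ α := by
  rw [Fintype.sum_prod_type]
  simp only [typeRestrict_apply, Matrix.submatrix_apply]
  have hb : ∀ b : Fin n, ∑ X : Γ, ‖(if s(b, Y'.1) = ℓ then C X Y'.2 else 0 : 𝕜)‖ = if s(b, Y'.1) = ℓ then ∑ X, ‖C X Y'.2‖ else 0 := by
    intro b
    split_ifs <;> simp
  simp only [hb]
  by_cases h : ∃ b, s(b, Y'.1) = ℓ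
  · obtain ⟨b₀, hb₀⟩ := h
    rw [Fintype.sum_eq_single b₀ fun b hb' => if_neg fun hb'' => hb' (Sym2.congr_left.1 (hb''.trans hb₀.symm)), if_pos hb₀]
    exact hcol _
  · rw [Fintype.sum_eq_zero _ fun b => if_neg fun hb' => h ⟨b, hb'⟩]
    exact hα

end ReplicaNorms

end Literature.MathematicalPhysics.QuantumLattice
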